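import Literature.AlgebraicGeometry.Resolution.KangarooAtlasCertGiraudForm

/-!
# Kangaroo atlas — Newton non-degeneracy in characteristic `p` (computable twin, certified rows)

New work of unit `pub-rosobs` / carver-g12 (placement: the cell topic `Summits/ResolutionOfSingularities/KangarooAtlas/`,
registered 2026-08-20; staged before that in the packet as `pub-rosobs-carver-g12/lean/NewtonNondegenerateCert.lean`, kernel-checked
with `lean check`). Filed in THREE modules for the 400-line limit: this file = the computable twin (univariate arithmetic over `𝔽_p`,
faces, Newton polygon from a certified vertex list) + the printed examples + Hauser's examples; `NewtonNondegenerateCertRows` = the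
131-row kangaroo table and the shade-1 rule; `NewtonNondegenerateCertRules` = the exhaustive boxes, the nine local types, the power
rule, the `q = p^e` and axis-point rules and the blind-spot family. The text below describes all three.

Companion of the statement-level typing `Literature/AlgebraicGeometry/Resolution/NewtonNondegenerate.lean`
(proposal p194795: `newtonPolyhedron`, `IsNondegenerateAlong`, `IsNewtonNondegenerate`, `IsWeaklyNewtonNondegenerate`,
`newtonNumber`, `IsNND1`, `IsWHNND`, the named facts `Thm33`, `Prop45`, `GNThm213`, `Thm413`, `GNThm312`, `GBPThm31`, …) in the
style of `KangarooAtlasCert*`: exact arithmetic over `𝔽_p` on sparse term lists (`Poly` of `KangarooAtlasCert`), univariate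
Euclid on coefficient lists, and kernel-checked rows (`decide`).  Computations, not theorems about resolution.

Sources.  [BGM12] Y. Boubakri, G.-M. Greuel, T. Markwig, *Invariants of hypersurface singularities in positive
characteristic*, Rev. Mat. Complut. 25 (2012), arXiv:1005.4503, §3–§4 [cite: BoubakriGreuelMarkwig2010]: `f` is
non-degenerate (ND) along a face `Δ` of the Newton polyhedron iff `jac(in_Δ f) = (x_i ∂ in_Δ f/∂x_i)` has no zero in the
torus `(K^*)^n`; Newton non-degenerate (NND) = ND along every (compact) face of the Newton diagram; weakly
non-degenerate along a facet iff the Tjurina ideal of `in_Δ f` has no zero in the torus; Remark 3.1: "if `f` is NND and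
`k·e_i ∈ Γ(f)` … then `char(K)` does not divide `k`"; Thm 3.3 / Prop 4.3 `μ_N(f) ≤ μ(f)`, Prop 4.5 `μ = μ_N` for NND;
Example 4.6: `char 2`, `f = x⁶ + y³ + x⁵y`, "`μ(f) = 13 > 10 = μ_N(f)`"; p.16: `char 2`, `f = (x−y)² + x⁵`,
"`μ_N(f) = 1`, `δ_N(f) = 1`" while `δ(f) = 2`.  [GN12] G.-M. Greuel, Nguyen H. D., *Some remarks on the planar
Kouchnirenko's theorem*, Rev. Mat. Complut. 25 (2012), arXiv:1009.4889 [cite: GreuelNguyen2010]: Lemma 2.3 (monotonicity of `μ_N` in `Γ₋`, with the formula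
`μ_N(f) = 2V₂(Γ₁(f)) + 1` in its proof), Def 2.9 (ND1 / NND1), Thm 2.13 (`μ_N(f) = μ(f) < ∞` iff `f_m = f + x^m + y^m` is NND1 for
large `m`), Example 2.1: `char 3`, `f = x³ + xy + y³`, "`μ(f) = μ_N(f) = 1` but `f` is not NND"; Prop 3.5 (WND along an
edge iff the face polynomial is squarefree).  [GBP22] E. R. García Barroso, A. Płoski, arXiv:2207.14523
[cite: GarciaBarrosoPloski2022] p.5: `x^p + y^{p+1}` (char `p`) is weakly (Bernstein–Płoski) non-degenerate and
Kouchnirenko degenerate.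

THIS TREE'S READING (atlas dictionary D12 of unit `pub-rosobs`, DERIVED conventions recorded in the atlas
documentation, never cited as theorems): a node of the `m = 2` kangaroo atlas is the cleaned walk state `F(y,z)` over `𝔽_p`
of `x^{p^e} + F` with exceptional multiplicities `r = (r_y, r_z)`; `F = y^{r_y} z^{r_z}·G`, `shade = ord G`; the PLANE CURVE
GERM read through [BGM12]/[GN12]/[GBP22] is `G` (and, for the Kouchnirenko condition and the weighted degree `N` only, the
total `F`).  A compact face of a bivariate Newton polygon is a vertex or an edge; along an edge with lattice points
`(a₀ + jα, b₀ − jβ)`, `j = 0..l`, the face polynomial in the torus coordinate `T = y^α z^{−β}` is `φ(T) = Σ c_j T^j`, and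
`y ∂/∂y`, `z ∂/∂z` of the initial form correspond to `Σ a_j c_j T^j`, `Σ b_j c_j T^j`; a family of polynomials over `𝔽_p`
has a common zero in the torus over the algebraic closure iff their gcd is not a monomial (decided by Euclid on
coefficient lists).  The TANGENT CONE is the face of weights `(1,1)` (the lowest-degree form `h`, read as `h(1,t)`); the
exceptional curve of a point blow-up is parametrised by the direction `t` (`z = t·y`), and the K-degeneracy of the
direction `t ≠ 0` for `F` is `(Σ a·c t^b)(t) = (Σ b·c t^b)(t) = 0` over the lowest form.  KANGAROO EXIT FORM: the child
state `F'` with multiplicities `r'` has `G' = w^s · U`, `U(0) ≠ 0`, `w` the NON-exceptional letter of the chart (`r'_w = 0`),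
`s = shade`.
Rows: the four printed examples above (Newton polygon certified from a vertex list: support on or above every edge
line, vertices in the support, strict convexity; `μ_N = 2A − (m+n) + 1`, `δ_N = (2A − (m+n) + Σ l)/2` from the certified
vertices; `μ` by `GiraudForm.fulton`), and one row per shade-increase edge of the `m = 2` atlas (131 edges: families
`bp2`, `whpert`, `moh`, `zoo`; `p^e ∈ {2, 3, 4, 5}`): `p ∣ ord F` at the parent, the kangaroo direction `t` is K-degenerate for
the tangent-cone face of `F`, the tangent-cone face polynomials of `F` have a common torus zero, and the child is in
KANGAROO EXIT FORM — so `w² ∣ G'` and `μ_N(G') = μ(G') = ∞` (D12: `μ_N(f) = sup_m μ_N(Γ₋(f_m))` is infinite iff `x² ∣ f` or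
`y² ∣ f`, elementary from the definition [BGM12, p.11] and the formula in the proof of [GN12] Lemma 2.3) while the parent `G`
has `μ_N(G) < ∞`.
-/

namespace Summit.ResolutionOfSingularities.KangarooAtlas

namespace NewtonND

open Literature.AlgebraicGeometry.Resolution.KangarooAtlasCert
open Literature.AlgebraicGeometry.Resolution.KangarooAtlasCert.GiraudForm (ex pderiv fulton)

set_option maxRecDepth 200000

/-! ## Univariate arithmetic over `𝔽_p` on coefficient lists (low degree first) -/

/-- coefficient list of a univariate polynomial over `𝔽_p`, lowest degree first. [folklore] -/
abbrev UPoly := List ℕ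

/-- reduce mod `p` and drop trailing zeros. [folklore] -/
def utrim (p : ℕ) (f : UPoly) : UPoly := ((f.map (· % p)).reverse.dropWhile (· == 0)).reverse

/-- number of leading zero coefficients = the power of `T` dividing `f` (for `f ≠ 0`). [folklore] -/
def ordT (f : UPoly) : ℕ := (f.takeWhile (· == 0)).length

/-- inverse in `𝔽_p` (`p` prime) by Fermat. [folklore] -/
def inv (p a : ℕ) : ℕ := a ^ (p - 2) % p

/-- `c · T^k · g` mod `p`. [folklore] -/
def shiftMul (p k c : ℕ) (g : UPoly) : UPoly := List.replicate k 0 ++ g.map (fun x => x * c % p)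

/-- coefficientwise difference mod `p` (lists of possibly different lengths). [folklore] -/
def subP (p : ℕ) : UPoly → UPoly → UPoly
  | [], g => g.map (fun x => (p - x % p) % p)
  | f, [] => f.map (· % p)
  | a :: f, b :: g => ((a % p + p - b % p) % p) :: subP p f g

/-- remainder of `f` by `g ≠ 0` (fuelled long division). [folklore] -/
def umod (p : ℕ) : ℕ → UPoly → UPoly → UPoly
  | 0, f, _ => utrim p f
  | fuel + 1, f, g =>
    let f := utrim p f
    let g := utrim p g
    if g.isEmpty then f
    else if f.length < g.length then f
    else
      let c := f.getLastD 0 * inv p (g.getLastD 0) % p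
      umod p fuel (subP p f (shiftMul p (f.length - g.length) c g)) g

/-- gcd up to a unit (fuelled Euclid). [folklore] -/
def ugcd (p : ℕ) : ℕ → UPoly → UPoly → UPoly
  | 0, f, _ => utrim p f
  | fuel + 1, f, g =>
    let g := utrim p g
    if g.isEmpty then utrim p f else ugcd p fuel g (umod p (f.length + 1) f g)

/-- the polynomials have a COMMON ZERO IN THE TORUS `T ≠ 0` over the algebraic closure of `𝔽_p`: their gcd is not a
monomial (all zero ⇒ true). [folklore] -/
def hasTorusRoot (p : ℕ) (fs : List UPoly) : Bool :=
  match (fs.map (utrim p)).filter (fun f => !f.isEmpty) with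
  | [] => true
  | f :: rest =>
    let g := rest.foldl (fun acc h => ugcd p (acc.length + h.length + 2) acc h) f
    decide (ordT g + 1 < g.length)

/-- Horner evaluation at `t` mod `p`. [folklore] -/
def ueval (p : ℕ) (f : UPoly) (t : ℕ) : ℕ := f.foldr (fun c acc => (c + t * acc) % p) 0

/-- formal derivative mod `p`. [folklore] -/
def uderiv (p : ℕ) (f : UPoly) : UPoly := utrim p ((f.zipIdx.map (fun ci => ci.1 * ci.2)).drop 1)

/-- `f` (with `f(0) ≠ 0` after removing the power of `T`) is squarefree over the algebraic closure: `gcd(f, f')` is a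
unit; `f' = 0` with `deg f ≥ 1` means not squarefree. [folklore] -/
def uSquarefreeTorus (p : ℕ) (f : UPoly) : Bool :=
  let f := (utrim p f).drop (ordT (utrim p f))
  if f.length ≤ 1 then true
  else
    let d := uderiv p f
    if d.isEmpty then false else (ugcd p (f.length + d.length + 2) f d).length == 1

/-! ## Bivariate data: support, coefficients, faces -/

/-- coefficient of the monomial `y^a z^b` in a normalised term list. [folklore] -/
def coeffOf (P : Poly) (a b : ℕ) : ℕ := ((P.filter (fun t => ex t.1 0 == a && ex t.1 1 == b)).headD ([], 0)).2

/-- the lowest-degree form (tangent cone) of `P`. [folklore] -/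
def lowestForm (p : ℕ) (P : Poly) : Poly :=
  let P := normalize p P
  P.filter (fun t => deg t.1 == ord P)

/-- tangent-cone face polynomials in the direction coordinate `t` (`z = t y`): index `b` carries the coefficient of
`y^{k−b} z^b`; returns `(h, Σ a·c t^b, Σ b·c t^b)` = (initial form, `y∂_y`, `z∂_z` restricted to `y = 1`).
[cite: BoubakriGreuelMarkwig2010, §3 (jac(in_Δ f))] -/
def coneFace (p : ℕ) (P : Poly) : UPoly × UPoly × UPoly :=
  let L := lowestForm p P
  let k := ord (normalize p P)
  let h := (List.range (k + 1)).map (fun b => coeffOf L (k - b) b % p)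
  (h, (List.range (k + 1)).map (fun b => (k - b) * coeffOf L (k - b) b % p),
      (List.range (k + 1)).map (fun b => b * coeffOf L (k - b) b % p))

/-- the direction `t ≠ 0` of the exceptional curve is a torus zero of `jac` of the tangent-cone initial form of `P`
(K-DEGENERATE direction). [cite: BoubakriGreuelMarkwig2010, §3] -/
def kdegDir (p : ℕ) (P : Poly) (t : ℕ) : Bool :=
  let c := coneFace p P
  ueval p c.2.1 t == 0 && ueval p c.2.2 t == 0

/-- the tangent-cone face of `P` is K-degenerate (some torus zero of `jac(in)`). [cite: BoubakriGreuelMarkwig2010, §3] -/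
def kdegCone (p : ℕ) (P : Poly) : Bool :=
  let c := coneFace p P
  hasTorusRoot p [c.2.1, c.2.2]

/-- `p ∣ ord P` (Hauser's necessary condition (1) for a kangaroo point, in the atlas normalisation). [cite: Hauser2010, §G] -/
def pDivOrd (p : ℕ) (P : Poly) : Bool := ord (normalize p P) % p == 0

/-- divide by the monomial `y^{r₀} z^{r₁}` (none if it does not divide). [folklore] -/
def stripMon (r : List ℕ) (P : Poly) : Option Poly :=
  if P.all (fun t => r.getD 0 0 ≤ ex t.1 0 && r.getD 1 0 ≤ ex t.1 1) then
    some (P.map (fun t => ([ex t.1 0 - r.getD 0 0, ex t.1 1 - r.getD 1 0], t.2)))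
  else none

/-- KANGAROO EXIT FORM of a child state `(F', r')`: `G' = F'/y^{r'_y} z^{r'_z}` equals `w^s · U` with `U(0) ≠ 0`, `w` the
letter `j` with `r'_j = 0` (non-exceptional) and `s = ord G' ≥ 1`; returns `(j, s)`. [cite: Hauser2010, §G] -/
def exitForm (p : ℕ) (F : Poly) (r : List ℕ) : Option (ℕ × ℕ) :=
  match stripMon r (normalize p F) with
  | none => none
  | some G =>
    let s := ord G
    if s == 0 then none
    else if r.getD 1 0 == 0 && G.all (fun t => s ≤ ex t.1 1) && coeffOf G 0 s % p != 0 then some (1, s)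
    else if r.getD 0 0 == 0 && G.all (fun t => s ≤ ex t.1 0) && coeffOf G s 0 % p != 0 then some (0, s)
    else none

/-! ## Newton polygon from a certified vertex list -/

/-- `V = [(a₀,b₀),…,(a_k,b_k)]` IS the vertex list of the Newton polygon (union of the compact faces of `Γ₊(P)`):
vertices lie in the support, `a` increases and `b` decreases strictly, consecutive edges turn strictly (convexity, so
every listed point is a vertex), and every support point lies on or above every edge line, to the right of `a₀` and
above `b_k`. [cite: BoubakriGreuelMarkwig2010, §3 (Γ₊(f), Γ(f))] -/
def isNewtonPolygon (p : ℕ) (P : Poly) (V : List (ℕ × ℕ)) : Bool :=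
  let P := normalize p P
  let E := V.zip (V.drop 1)
  !V.isEmpty &&
  V.all (fun v => coeffOf P v.1 v.2 % p != 0) &&
  E.all (fun e => e.1.1 < e.2.1 && e.2.2 < e.1.2) &&
  (E.zip (E.drop 1)).all (fun ee =>
    -- slopes strictly increase: (b₁−b₀)(a₂−a₁) < (b₂−b₁)(a₁−a₀) with negative numerators, i.e.
    -- (b₀−b₁)(a₂−a₁) > (b₁−b₂)(a₁−a₀)
    (ee.2.1.2 - ee.2.2.2) * (ee.1.2.1 - ee.1.1.1) < (ee.1.1.2 - ee.1.2.2) * (ee.2.2.1 - ee.2.1.1)) &&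
  P.all (fun t => (V.headD (0, 0)).1 ≤ ex t.1 0 && (V.getLastD (0, 0)).2 ≤ ex t.1 1 &&
    E.all (fun e => (e.1.2 - e.2.2) * e.1.1 + (e.2.1 - e.1.1) * e.1.2 ≤ (e.1.2 - e.2.2) * ex t.1 0 + (e.2.1 - e.1.1) * ex t.1 1))

/-- twice the area between a CONVENIENT polygon (`a₀ = 0`, `b_k = 0`) and the axes (shoelace over the lattice polygon
`(0,0), (a_k,0), …, (0,b₀)`), computed edge by edge as `Σ (a_{i+1} b_i − a_i b_{i+1})`. [cite: BoubakriGreuelMarkwig2010, §3 (V_2)] -/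
def area2 (V : List (ℕ × ℕ)) : ℕ := ((V.zip (V.drop 1)).map (fun e => e.2.1 * e.1.2 - e.1.1 * e.2.2)).sum

/-- lattice length of the polygon: `Σ gcd(Δa, Δb)`. [cite: BoubakriGreuelMarkwig2010, §4 (l(Δ))] -/
def latticeLen (V : List (ℕ × ℕ)) : ℕ := ((V.zip (V.drop 1)).map (fun e => Nat.gcd (e.2.1 - e.1.1) (e.1.2 - e.2.2))).sum

/-- Newton number of a convenient bivariate polygon: `μ_N = 2V₂ − V₁ + 1`, `V₁ = a_k + b₀`.
[cite: BoubakriGreuelMarkwig2010, §3 (μ_N)] -/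
def newtonNumber2 (V : List (ℕ × ℕ)) : ℕ := area2 V + 1 - ((V.getLastD (0, 0)).1 + (V.headD (0, 0)).2)

/-- twice the Newton delta-invariant of a convenient bivariate polygon: `2δ_N = 2V₂ − V₁ + Σ l(Δ)`.
[cite: BoubakriGreuelMarkwig2010, §4 (δ_N)] -/
def twoDeltaN (V : List (ℕ × ℕ)) : ℕ := area2 V + latticeLen V - ((V.getLastD (0, 0)).1 + (V.headD (0, 0)).2)

/-- face polynomials of the edge from vertex `v₀` to `v₁` of `P` with exponent offsets `(o_y, o_z)` (for the total
`F = y^{o_y} z^{o_z} P`): `(φ, Σ (a_j+o_y) c_j T^j, Σ (b_j+o_z) c_j T^j)` over the lattice points `(a₀ + jα, b₀ − jβ)`.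
[cite: BoubakriGreuelMarkwig2010, §3] -/
def edgeFace (p : ℕ) (P : Poly) (v₀ v₁ : ℕ × ℕ) (oy oz : ℕ) : UPoly × UPoly × UPoly :=
  let P := normalize p P
  let l := Nat.gcd (v₁.1 - v₀.1) (v₀.2 - v₁.2)
  let α := (v₁.1 - v₀.1) / l
  let β := (v₀.2 - v₁.2) / l
  let js := List.range (l + 1)
  (js.map (fun j => coeffOf P (v₀.1 + j * α) (v₀.2 - j * β) % p),
   js.map (fun j => (v₀.1 + j * α + oy) * coeffOf P (v₀.1 + j * α) (v₀.2 - j * β) % p),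
   js.map (fun j => (v₀.2 - j * β + oz) * coeffOf P (v₀.1 + j * α) (v₀.2 - j * β) % p))

/-- K-NON-DEGENERATE along every vertex and edge of the certified polygon `V` (Kouchnirenko / [BGM12] NND for a
bivariate germ; at a vertex `(a,b)`: not both `p ∣ a+o_y` and `p ∣ b+o_z`). [cite: BoubakriGreuelMarkwig2010, §3 (NND), Rem. 3.1] -/
def isKND (p : ℕ) (P : Poly) (V : List (ℕ × ℕ)) (oy oz : ℕ) : Bool :=
  V.all (fun v => !((v.1 + oy) % p == 0 && (v.2 + oz) % p == 0)) &&
  (V.zip (V.drop 1)).all (fun e => let f := edgeFace p P e.1 e.2 oy oz; !hasTorusRoot p [f.2.1, f.2.2])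

/-- WEAKLY NON-DEGENERATE along every edge (top-dimensional face) of the certified polygon: the Tjurina system
`(φ, φ_y, φ_z)` has no torus zero. [cite: BoubakriGreuelMarkwig2010, §3 (WND)] -/
def isWND (p : ℕ) (P : Poly) (V : List (ℕ × ℕ)) : Bool :=
  (V.zip (V.drop 1)).all (fun e => let f := edgeFace p P e.1 e.2 0 0; !hasTorusRoot p [f.1, f.2.1, f.2.2])

/-- every edge face polynomial is squarefree in the torus (`s(f_S) = l(S)`), the criterion of [GN12] Prop. 3.5 for WND
along the edge. [cite: GreuelNguyen2010, Prop. 3.5] -/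
def edgesSquarefree (p : ℕ) (P : Poly) (V : List (ℕ × ℕ)) : Bool :=
  (V.zip (V.drop 1)).all (fun e => uSquarefreeTorus p (edgeFace p P e.1 e.2 0 0).1)

/-- [GN12] Def. 2.9 (ND1) at the axis vertices of a CONVENIENT certified polygon: at `(0,n)` either `p ∤ n` or the point
`(1, j)` of the first edge is a lattice point with non-zero coefficient; symmetrically at `(m,0)`. [cite: GreuelNguyen2010, Def. 2.9] -/
def isND1Axes (p : ℕ) (P : Poly) (V : List (ℕ × ℕ)) : Bool :=
  let P := normalize p P
  let okTop := match V with
    | (0, n) :: (a₁, b₁) :: _ => n % p != 0 || ((n - b₁) % a₁ == 0 && coeffOf P 1 (n - (n - b₁) / a₁) % p != 0)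
    | (0, n) :: [] => n % p != 0
    | _ => true
  let W := V.reverse
  let okRight := match W with
    | (m, 0) :: (a₁, b₁) :: _ => m % p != 0 || ((m - a₁) % b₁ == 0 && coeffOf P (m - (m - a₁) / b₁) 1 % p != 0)
    | (m, 0) :: [] => m % p != 0
    | _ => true
  okTop && okRight

/-! ## Certified rows — the printed examples -/

/-- [BGM12] Example 4.6, `char 2`, `f = y⁶ + z³ + y⁵z`. [cite: BoubakriGreuelMarkwig2010, Ex. 4.6] -/
def bgm46 : Poly := [([6, 0], 1), ([0, 3], 1), ([5, 1], 1)]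

/-- `Γ(f)` is the segment `(0,3)–(6,0)`; `μ_N = 2·9 − 9 + 1 = 10`; `2δ_N = 18 + 3 − 9 = 12`; `f` is K-degenerate at the
vertex `(6,0)` (both coordinates even; along the edge `jac(in) = (0, z³)` has no torus zero), not ND1 there (`2 ∣ 6` and the
point `(4,1)` of `Γ` has coefficient `0`), and `μ(f) = 13` by Fulton on `(f_y, f_z) = (y⁴z, z² + y⁵)`:
"`μ(f) = 13 > 10 = μ_N(f)`". [cite: BoubakriGreuelMarkwig2010, Ex. 4.6] -/
theorem bgm46_row :
    isNewtonPolygon 2 bgm46 [(0, 3), (6, 0)] = true ∧ newtonNumber2 [(0, 3), (6, 0)] = 10 ∧ twoDeltaN [(0, 3), (6, 0)] = 12 ∧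
    isKND 2 bgm46 [(0, 3), (6, 0)] 0 0 = false ∧ isND1Axes 2 bgm46 [(0, 3), (6, 0)] = false ∧
    fulton 2 40 (pderiv 2 0 bgm46) (pderiv 2 1 bgm46) = some 13 := by
  decide

/-- [GN12] Example 2.1, `char 3`, `f = y³ + yz + z³`: `Γ(f)` has vertices `(0,3),(1,1),(3,0)`, `μ_N = 2·3 − 6 + 1 = 1`,
`f` is NOT NND (the vertex `(3,0)` resp. `(0,3)` has both coordinates divisible by `3`) but it is ND1 at both axis
vertices (`(1,1) ∈ Γ(f)` with coefficient `1`) and K-non-degenerate along both edges and the inner vertex, and `μ(f) = 1`: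
"`μ(f) = μ_N(f) = 1` but `f` is not NND". [cite: GreuelNguyen2010, Ex. 2.1] -/
def gn21 : Poly := [([3, 0], 1), ([1, 1], 1), ([0, 3], 1)]

/-- the certified row of `gn21` ([GN12] Example 2.1, see its docstring): Newton polygon, `μ_N = 1`, not K-ND on the full polygon but K-ND at the inner vertex, ND1 at the axes, `μ = 1` by Fulton. [cite: GreuelNguyen2010, Ex. 2.1] -/
theorem gn21_row :
    isNewtonPolygon 3 gn21 [(0, 3), (1, 1), (3, 0)] = true ∧ newtonNumber2 [(0, 3), (1, 1), (3, 0)] = 1 ∧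
    isKND 3 gn21 [(0, 3), (1, 1), (3, 0)] 0 0 = false ∧ isKND 3 gn21 [(1, 1)] 0 0 = true ∧
    isND1Axes 3 gn21 [(0, 3), (1, 1), (3, 0)] = true ∧
    fulton 3 40 (pderiv 3 0 gn21) (pderiv 3 1 gn21) = some 1 := by
  decide

/-- [GBP22] p.5: `char 5`, `f = y⁵ + z⁶` is weakly non-degenerate (the edge `(0,6)–(5,0)` is primitive, `φ = 1 + T`, and the
Tjurina system `(1 + T, 0, 6)` has no torus zero) but Kouchnirenko degenerate (vertex `(5,0)`), `μ_N = 30 − 11 + 1 = 20`, and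
`f_y = 5y⁴ = 0` (so `μ(f) = ∞`). [cite: GarciaBarrosoPloski2022, §2 (5)] -/
def gbp : Poly := [([5, 0], 1), ([0, 6], 1)]

/-- the certified row of `gbp` ([GBP22] p.5, see its docstring): Newton polygon, weakly non-degenerate, Kouchnirenko degenerate, `μ_N = 20`, `f_y = 0`. [cite: GarciaBarrosoPloski2022, §2 (5)] -/
theorem gbp_row :
    isNewtonPolygon 5 gbp [(0, 6), (5, 0)] = true ∧ isWND 5 gbp [(0, 6), (5, 0)] = true ∧
    isKND 5 gbp [(0, 6), (5, 0)] 0 0 = false ∧ newtonNumber2 [(0, 6), (5, 0)] = 20 ∧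
    pderiv 5 0 gbp = [] := by
  decide

/-- [BGM12] p.16: `char 2`, `f = (y − z)² + y⁵ = y² + z² + y⁵`: `Γ(f)` is the segment `(0,2)–(2,0)`, `μ_N = 4 − 4 + 1 = 1`,
`2δ_N = 4 + 2 − 4 = 2` ("`μ_N(f) = 1`, `δ_N(f) = 1`"), and `f` is weakly degenerate along the edge (`φ = (1+T)²`).
[cite: BoubakriGreuelMarkwig2010, §4 p.16] -/
def bgm16 : Poly := [([2, 0], 1), ([0, 2], 1), ([5, 0], 1)]

/-- the certified row of `bgm16` ([BGM12] p.16, see its docstring): Newton polygon, `μ_N = 1`, `2δ_N = 2`, weakly degenerate along the edge, edge polynomial not squarefree. [cite: BoubakriGreuelMarkwig2010, §4 p.16] -/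
theorem bgm16_row :
    isNewtonPolygon 2 bgm16 [(0, 2), (2, 0)] = true ∧ newtonNumber2 [(0, 2), (2, 0)] = 1 ∧ twoDeltaN [(0, 2), (2, 0)] = 2 ∧
    isWND 2 bgm16 [(0, 2), (2, 0)] = false ∧ edgesSquarefree 2 bgm16 [(0, 2), (2, 0)] = false := by
  decide

/-- Transplant verdict for the surface: `x^q + F(y,z)` in characteristic `p ∣ q` has the vertex `q·e_x` on its Newton
diagram with all coordinates divisible by `p`, so it is NOT Newton non-degenerate ([BGM12] Remark 3.1: "if `f` is NND
and `k·e_i ∈ Γ(f)` then `char(K)` does not divide `k`").  Instance `p = q = 2`, `F` = Hauser's `y⁷ + yz⁴`: the vertex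
`(2,0,0)` is K-degenerate (vertex test `isKND` on the one-point polygon in the letters `(x, y)` of `x² + y⁷`).
[cite: BoubakriGreuelMarkwig2010, Rem. 3.1] -/
theorem surface_vertex_degenerate :
    isKND 2 [([2, 0], 1), ([0, 7], 1)] [(2, 0)] 0 0 = false ∧ isKND 3 [([3, 0], 1)] [(3, 0)] 0 0 = false ∧
    isKND 5 [([5, 0], 1)] [(5, 0)] 0 0 = false ∧ isKND 2 [([4, 0], 1)] [(4, 0)] 0 0 = false := by
  decide

/-! ## Certified rows — Hauser's examples read through the tangent-cone face -/

/-- Hauser's antelope state `y³z³(y² + z²)`, `p = 2`: `ord = 8` is even, the kangaroo direction `t = 1` is a torus zero of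
`jac` of the tangent-cone form (`y∂_y`, `z∂_z` of `y⁵z³ + y³z⁵` at `(1,t)`: `5t³ + 3t⁵ ≡ t³ + t⁵`, `3t³ + 5t⁵ ≡ t³ + t⁵`,
both vanish at `t = 1`), the cone face is K-degenerate, and the residual `G = y² + z²` has Newton number `1` (finite).
[cite: Hauser2010, §G] -/
theorem antelope_direction :
    pDivOrd 2 GiraudForm.antelope = true ∧ kdegDir 2 GiraudForm.antelope 1 = true ∧ kdegCone 2 GiraudForm.antelope = true ∧
    newtonNumber2 [(0, 2), (2, 0)] = 1 ∧ isNewtonPolygon 2 [([2, 0], 1), ([0, 2], 1)] [(0, 2), (2, 0)] = true := by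
  decide

/-- … and the kangaroo child `y⁶z³ + y⁶z⁵` with `r' = (6, 0)` is in EXIT FORM: `G' = z³(1 + z²)`, `w = z` non-exceptional,
`s = 3` — so `z² ∣ G'` and `μ_N(G') = μ(G') = ∞` (D12 infinity criterion), Fulton detects the common component (`none`).
[cite: Hauser2010, §G] -/
theorem kangaroo_exit :
    exitForm 2 GiraudForm.kangaroo [6, 0] = some (1, 3) ∧
    fulton 2 40 (pderiv 2 0 [([0, 3], 1), ([0, 5], 1)]) (pderiv 2 1 [([0, 3], 1), ([0, 5], 1)]) = none := by
  decide

end NewtonND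

end Summit.ResolutionOfSingularities.KangarooAtlas
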